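import Literature.AlgebraicGeometry.Frobenioids.Cor26SubProofs
import Literature.AlgebraicGeometry.Frobenioids.ArchimedeanCharSplitting
import Literature.AlgebraicGeometry.Frobenioids.ArchimedeanStandardTypeProofs
import Literature.AlgebraicGeometry.Frobenioids.ArchimedeanAmpleness
import Literature.AlgebraicGeometry.Frobenioids.ArchimedeanFrobenioidRelative
import HarnessLib

/-!
# [FrdI] Cor. 2.6: the data `Cor26Data` and the setting `FrdI.P25.Setting` are INHABITED
# (non-vacuity witnesses; row «NV-L1/FrdI.P25.Cor26Data + FrdI.P25.Setting»)

Mochizuki, *The geometry of Frobenioids I: the general theory*, Kyushu J. Math. **62** (2008)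
293–400, §2, Prop. 2.5 (p. 48) and Cor. 2.6 (pp. 50–51), kurims text
[cite: MochizukiFrdI2008, Cor. 2.6 p.50]; *The geometry of Frobenioids II: poly-Frobenioids*,
Kyushu J. Math. **62** (2008) 401–460, §3, Ex. 3.3 (ii) p. 28 and Thm. 3.6 (i) p. 36
[cite: MochizukiFrdII2008, Thm 3.6 (i) p.36].

PROOF-ONLY file (no definitions).  The kernel inhabitation censuses of 2026-08-26 (abc-iut-w5-d197
L1 census v1 §A; abc-iut-w5-d056 cell census v3 rows 343–344) list the structure
`FrdI.P25.Cor26Data` (8 consumers) and the `Prop`-structure `FrdI.P25.Setting` (6 consumers) of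
`Prop25Sub.lean` with ZERO producers: every discharged row of [FrdI] Cor. 2.6
(`Cor26Data.psi_eq`, `unitWise_a_holds` … `unitWise_d_holds`, `Cor26SubProofs.lean`) quantifies
over `Δ : Cor26Data τ d hF` under `Setting F`.  This file closes both rows:

* GENERIC (`Cor26Data.nonempty`, `Cor26Data.subsingleton`, `Cor26Data.nonempty_unique`): under the
  printed hypotheses of Cor. 2.6 (`Setting F`: a Frobenioid of Frobenius-normalized, metrically
  trivial and `Aut`-ample type) the data `(Ψ₁, U)` of the construction "`Ψ := Ψ₂ ∘ Ψ₁`" EXISTS for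
  every characteristic splitting `τ` and every `d` — assembled from the LANDED rows C26-L01
  (`naiveFactorsThroughCd_holds`, abc-iut-L1-t2) and P25-L07/L08 (`psiUnitLinearData_holds`,
  `psiEquivalence_holds`) — and is UNIQUE (`Cor26Data.Ψ₁_eq`,
  `unitLinearFrobeniusData_eq_of_isPsiValue`): the universally quantified rows speak about exactly
  one object.
* GENUINE (`ArchFrd.setting_C`, `ArchFrd.nonempty_cor26Data_C`, and the base-free instances
  `ArchFrd.setting_C_D0`, `ArchFrd.nonempty_cor26Data_C_D0`): the setting holds, and the data exist,
  at the archimedean Frobenioid `C = C₀ ×_{D₀} D` of [FrdII] Ex. 3.3 over any connected, totally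
  epimorphic base `D → D₀` (in particular over `D₀` itself), with the characteristic splitting of
  [FrdII] Thm. 3.6 (i) (`ArchFrd.charSplitting`, abc-iut-L1-t9) — the context in which print APPLIES
  Cor. 2.6 ([FrdII] §3, unit-wise Frobenius functors of archimedean Frobenioids).  Inputs BY NAME:
  `ArchFrd.Ex33ii_isFrobenioid_holds` ("`C` is a Frobenioid"), `ArchFrd.C.isOfFrobeniusNormalizedType`,
  `ArchFrd.isMetricallyTrivial_C`, `ArchFrd.isAutAmple_C` (Thm. 3.6 (i) type clauses),
  `ArchFrd.D0.isGraphConnected`, `ArchFrd.D0.isTotallyEpimorphic`.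

Grading (honest): the `ArchFrd` witnesses are GENUINE (real objects of [FrdII] §3, no toy, no
degenerate parameter); the generic producer is exactly as strong as the hypotheses of Cor. 2.6.  A
zero census row is "not yet witnessed", never "vacuous".  No statement of either paper is
strengthened or weakened; nothing here bears on [IUTchIII]; no side taken on Cor. 3.12; typed ≠ proved.
-/

namespace Literature.AlgebraicGeometry.Frobenioids

open CategoryTheory Opposite

noncomputable section

universe w v v' u u'

/-! ### Generic producers: the data of Cor. 2.6 exist (uniquely) under its hypotheses -/

namespace FrdI.P25

open PreFrobenioid

variable {D : Type u} [Category.{v} D] {Φ : Dᵒᵖ ⥤ CommMonCat.{w}}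
  {C : Type u'} [Category.{v'} C] {F : C ⥤ ElemFrobenioid Φ}

/-- The data of Cor. 2.6 from its three printed ingredients, kept as named hypotheses: a
factorisation of the naive Frobenius functor through `C(d)` (C26-L01), a unit-linear Frobenius
datum realising the `Ψ`-values (P25-L07) and its being an equivalence (P25-L08) — the construction
of the typer's `assembly26`, exposed. [cite: MochizukiFrdI2008, Cor. 2.6 p.51] -/
theorem Cor26Data.nonempty_of_rows (hS : Setting F) (τ : CharacteristicSplitting F) (d : ℕ+)
    (h1 : NaiveFactorsThroughCd F d) (h7 : PsiUnitLinearData F τ d) (h8 : PsiEquivalence F τ d) :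
    Nonempty (Cor26Data τ d hS.isFrobenioid) := by
  obtain ⟨Ψ₁, hΨ₁⟩ := h1 hS.isFrobenioid
  obtain ⟨U, hU, -⟩ := h7 hS
  exact ⟨⟨Ψ₁, hΨ₁, U, hU, h8 hS U hU⟩⟩

/-- **`Cor26Data` is inhabited** whenever the hypotheses of [FrdI] Cor. 2.6 hold (`Setting F`), for
every characteristic splitting `τ` and every `d ∈ N_{≥1}`: rows C26-L01 (`naiveFactorsThroughCd_holds`)
and P25-L07/L08 (`psiUnitLinearData_holds`, `psiEquivalence_holds`) are discharged in the tree.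
[cite: MochizukiFrdI2008, Cor. 2.6 p.51] -/
theorem Cor26Data.nonempty (hS : Setting F) (τ : CharacteristicSplitting F) (d : ℕ+) :
    Nonempty (Cor26Data τ d hS.isFrobenioid) :=
  Cor26Data.nonempty_of_rows hS τ d (naiveFactorsThroughCd_holds F d) (psiUnitLinearData_holds τ d)
    (psiEquivalence_holds τ d)

/-- **`Cor26Data` is rigid**: `Ψ₁` is determined by "factors through `C(d) ⊆ C`"
(`Cor26Data.Ψ₁_eq`) and the unit-linear Frobenius datum by its `Ψ`-values
(`unitLinearFrobeniusData_eq_of_isPsiValue`); the remaining fields are propositions.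
[cite: MochizukiFrdI2008, Cor. 2.6 p.51] -/
theorem Cor26Data.subsingleton (hS : Setting F) (τ : CharacteristicSplitting F) (d : ℕ+) :
    Subsingleton (Cor26Data τ d hS.isFrobenioid) := by
  refine ⟨fun Δ Δ' => ?_⟩
  have h1 := Δ.Ψ₁_eq
  have h1' := Δ'.Ψ₁_eq
  have h2 := unitLinearFrobeniusData_eq_of_isPsiValue hS τ d Δ.U Δ.U_spec
  have h2' := unitLinearFrobeniusData_eq_of_isPsiValue hS τ d Δ'.U Δ'.U_spec
  obtain ⟨Ψ₁, hΨ₁, U, hU, hE⟩ := Δ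
  obtain ⟨Ψ₁', hΨ₁', U', hU', hE'⟩ := Δ'
  dsimp only at h1 h1' h2 h2'
  subst h1 h2 h1' h2'
  rfl

/-- The data of Cor. 2.6 exist AND are unique: the construction "`Ψ := Ψ₂ ∘ Ψ₁`" has exactly one
datum `(Ψ₁, U)` in the typed sense. [cite: MochizukiFrdI2008, Cor. 2.6 p.51] -/
theorem Cor26Data.nonempty_unique (hS : Setting F) (τ : CharacteristicSplitting F) (d : ℕ+) :
    Nonempty (Cor26Data τ d hS.isFrobenioid) ∧ Subsingleton (Cor26Data τ d hS.isFrobenioid) :=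
  ⟨Cor26Data.nonempty hS τ d, Cor26Data.subsingleton hS τ d⟩

/-- Consequently the unit-wise Frobenius functor `Δ.psi` does not depend on the datum `Δ`.
[cite: MochizukiFrdI2008, Cor. 2.6 p.51] -/
theorem Cor26Data.psi_eq_psi (hS : Setting F) {τ : CharacteristicSplitting F} {d : ℕ+}
    (Δ Δ' : Cor26Data τ d hS.isFrobenioid) : Δ.psi = Δ'.psi := by
  rw [(Cor26Data.subsingleton hS τ d).elim Δ Δ']

end FrdI.P25

/-! ### Genuine witnesses: the archimedean Frobenioid `C = C₀ ×_{D₀} D` of [FrdII] Ex. 3.3 -/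

namespace ArchFrd

variable {D : Type u} [Category.{v} D] (π : D ⥤ D0)

/-- **The hypotheses of [FrdI] Prop. 2.5 / Cor. 2.6 hold for the archimedean Frobenioid `C`** over a
connected, totally epimorphic base ([FrdII] Ex. 3.3 (ii): "`C` is a Frobenioid"; Thm. 3.6 (i): of
`Aut`-ample, metrically trivial and Frobenius-normalized type) — a GENUINE inhabitant of
`FrdI.P25.Setting`. [cite: MochizukiFrdII2008, Thm 3.6 (i) p.36] -/
theorem setting_C (hDc : IsGraphConnected D) (hDe : IsTotallyEpimorphic D) :
    FrdI.P25.Setting (C.toElem π) where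
  isFrobenioid := Ex33ii_isFrobenioid_holds π hDc hDe
  frobeniusNormalized := fun A => (C.isOfFrobeniusNormalizedType π).obj A
  metricallyTrivial := fun A => isMetricallyTrivial_C π A
  autAmple := fun A => isAutAmple_C π A

/-- **`Cor26Data` is GENUINELY inhabited**: at the archimedean Frobenioid `C` over a connected,
totally epimorphic base, with the characteristic splitting of [FrdII] Thm. 3.6 (i)
(`ArchFrd.charSplitting`: the radial elements of `O^▷(−)`), for every `d ∈ N_{≥1}` — the setting in
which [FrdII] §3 applies the unit-wise Frobenius functor of [FrdI] Cor. 2.6.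
[cite: MochizukiFrdII2008, Thm 3.6 (i) p.36] -/
theorem nonempty_cor26Data_C (hDc : IsGraphConnected D) (hDe : IsTotallyEpimorphic D) (d : ℕ+) :
    Nonempty (FrdI.P25.Cor26Data (charSplitting π) d (setting_C π hDc hDe).isFrobenioid) :=
  FrdI.P25.Cor26Data.nonempty (setting_C π hDc hDe) (charSplitting π) d

/-- … and the datum there is unique. [cite: MochizukiFrdII2008, Thm 3.6 (i) p.36] -/
theorem subsingleton_cor26Data_C (hDc : IsGraphConnected D) (hDe : IsTotallyEpimorphic D) (d : ℕ+) :
    Subsingleton (FrdI.P25.Cor26Data (charSplitting π) d (setting_C π hDc hDe).isFrobenioid) :=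
  FrdI.P25.Cor26Data.subsingleton (setting_C π hDc hDe) (charSplitting π) d

/-- Hypothesis-free instance: the setting holds for `C` over the base `D₀` itself (`π = 𝟭 D₀`;
`D₀` is connected and totally epimorphic, `D0.isGraphConnected`, `D0.isTotallyEpimorphic`).
[cite: MochizukiFrdII2008, Thm 3.6 (i) p.36] -/
theorem setting_C_D0 : FrdI.P25.Setting (C.toElem (𝟭 D0)) :=
  setting_C (𝟭 D0) D0.isGraphConnected D0.isTotallyEpimorphic

/-- Hypothesis-free instance: `Cor26Data` is inhabited at `C` over `D₀`, for every `d`.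
[cite: MochizukiFrdII2008, Thm 3.6 (i) p.36] -/
theorem nonempty_cor26Data_C_D0 (d : ℕ+) :
    Nonempty (FrdI.P25.Cor26Data (charSplitting (𝟭 D0)) d setting_C_D0.isFrobenioid) :=
  nonempty_cor26Data_C (𝟭 D0) D0.isGraphConnected D0.isTotallyEpimorphic d

end ArchFrd

end

end Literature.AlgebraicGeometry.Frobenioids
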